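import Mathlib
import Summits.NavierStokesRegularity.NavierStokesRegularity.Theorems.FilamentSkeletonRssClause13TransportAveraging

/-!
# Clause 13-J/13-R, brick m3b-U (POINTWISE TRANSPORT FROM THE STAGNATION POINT): damped fences started AT the waist `w(c) = 0`

Route `FilamentSkeletonRss`, ∃-side clause 13 (`Clause13RNearStraightL`, stmt-NavierStokesRegularity-23612; typing-agnostic).  Design of record
rev 80 (NOT DECOMPOSED YET: m3b = director default (ii) with tenure note R-m3b-2): in the ultra-high band at the waist the device is POINTWISE
TRANSPORT for the regular–singular ODE `w·z′ = iG·z + α·z + β·z̄ + f` at the simple zero `w(c) = 0` of the slip; `G` only rotates the phase,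
`C¹`-regularity excludes the homogeneous branches, and outward integration gives `|z(τ)| ≤ C·sup|f|`, linear in the defect and `Γ`-free.
The landed fences (`transport_norm_le_of_damped`, p≈g13 `…Clause13TransportFence`; `farBranch_norm_le_of_damped`,
`…Clause13TransportAveraging`) need `w > 0` on the CLOSED interval and an initial bound at its left end; this file starts them at the
stagnation point itself:
* §1 `norm_le_of_stagnation` — at `w(c) = 0` the ODE is algebraic, `0 = B·Y(c) + F(c)`, so damping `⟪By, y⟫ ≤ −β₀‖y‖²` gives
  `‖Y(c)‖ ≤ ‖F(c)‖/β₀`; `transport_norm_le_of_damped_stagnation` — `w(c) = 0`, `w > 0` on `(c, b]`, damping and `‖F‖ ≤ M` on `[c, b]`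
  ⟹ `‖Y‖ ≤ M/β₀` on `[c, b]` (real inner-product version; continuity at `c` + the landed forward fence on `[a, b]`, `a ↓ c`);
* §2 `norm_le_of_stagnation_rot` — lab frame with the rotation: `0 = iG z + α z + β z̄ + f` ⟹ `(G − ‖α‖ − ‖β‖)‖z‖ ≤ ‖f‖`;
  ★ `waist_norm_le_of_damped` — for `w·z′ = iG z + α z + β z̄ + f` on `[c, b]` with `w(c) = 0`, `w > 0` on `(c, b]`, `w` continuous,
  `‖f‖ ≤ M`, `‖β‖ ≤ G`, the J-averaged damping margin `β₀ ≤ −Re α − (k/(1−k))(2|Im α| + k‖β‖)` (`k = ‖β‖/(2G)`) and `β₀ ≤ G − ‖α‖ − ‖β‖`: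
  `‖z τ‖ ≤ ((1+k)M/β₀)/(1−k)` on `[c, b]` — the rotating frame `θ = ∫ G/w` is built on `[a, b]`, `a > c` (it is singular at `c`: the phase
  spins infinitely fast into the stagnation point, but `‖e^{−iθ}z‖ = ‖z‖` is continuous there), and `rotatingFrame` +
  `farBranch_norm_le_of_damped` are applied with `a ↓ c`.
Lane ns-filament-19175-p1 g17; `--supports stmt-NavierStokesRegularity-23612 --as helper`.
HONEST FRAMING: ODE lemmas for the bookkeeping of a HYPOTHETICAL filament skeleton on the NEGATIVE side of a MODEL route; nothing here bears on
Navier–Stokes regularity or blow-up.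
-/

noncomputable section

open scoped InnerProductSpace ComplexConjugate
open Set Complex MeasureTheory Filter Topology

namespace Summit.NavierStokesRegularity.NavierStokesRegularity.Theorems.Clause13Transport
set_option linter.dupNamespace false

variable {E : Type*} [NormedAddCommGroup E] [InnerProductSpace ℝ E]

/-! ## §1 Real inner-product version -/

/-- **At the stagnation point the ODE is algebraic**: `0 = B Y + F` with `⟪B y, y⟫ ≤ −β₀‖y‖²` and `‖F‖ ≤ M` ⟹ `‖Y‖ ≤ M/β₀`. [folklore] -/
theorem norm_le_of_stagnation {Y F : E} {B : E →L[ℝ] E} {M β₀ : ℝ} (hβ₀ : 0 < β₀) (hM : 0 ≤ M)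
    (hode : (0 : E) = B Y + F) (hB : ∀ y : E, ⟪B y, y⟫_ℝ ≤ -(β₀ * ‖y‖ ^ 2)) (hF : ‖F‖ ≤ M) : ‖Y‖ ≤ M / β₀ := by
  have hBY : B Y = -F := eq_neg_of_add_eq_zero_left hode.symm
  have h1 : ⟪B Y, Y⟫_ℝ = -⟪F, Y⟫_ℝ := by rw [hBY, inner_neg_left]
  have h2 : |⟪F, Y⟫_ℝ| ≤ ‖F‖ * ‖Y‖ := abs_real_inner_le_norm F Y
  have h3 := hB Y
  have h4 : β₀ * ‖Y‖ ^ 2 ≤ M * ‖Y‖ := by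
    nlinarith [(abs_le.1 h2).2, mul_le_mul_of_nonneg_right hF (norm_nonneg Y)]
  rw [le_div_iff₀ hβ₀]
  by_cases hY : ‖Y‖ = 0
  · rw [hY, zero_mul]; exact hM
  · have hYpos : 0 < ‖Y‖ := lt_of_le_of_ne (norm_nonneg _) (Ne.symm hY)
    nlinarith

/-- **Damped transport started at the stagnation point (real version).**  `w•Y′ = B Y + F` on `[c, b]`, `w(c) = 0`, `w > 0` on `(c, b]`,
`⟪B τ y, y⟫ ≤ −β₀‖y‖²`, `‖F‖ ≤ M` ⟹ `‖Y τ‖ ≤ M/β₀` on `[c, b]`. [folklore] -/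
theorem transport_norm_le_of_damped_stagnation {Y Y' F : ℝ → E} {B : ℝ → E →L[ℝ] E} {w : ℝ → ℝ} {c b M β₀ : ℝ}
    (hβ₀ : 0 < β₀) (hM : 0 ≤ M) (hderiv : ∀ τ ∈ Icc c b, HasDerivAt Y (Y' τ) τ)
    (hode : ∀ τ ∈ Icc c b, w τ • Y' τ = B τ (Y τ) + F τ) (hwc : w c = 0) (hw : ∀ τ ∈ Ioc c b, 0 < w τ)
    (hB : ∀ τ ∈ Icc c b, ∀ y : E, ⟪B τ y, y⟫_ℝ ≤ -(β₀ * ‖y‖ ^ 2)) (hF : ∀ τ ∈ Icc c b, ‖F τ‖ ≤ M) :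
    ∀ τ ∈ Icc c b, ‖Y τ‖ ≤ M / β₀ := by
  intro τ hτ
  have hc : c ∈ Icc c b := left_mem_Icc.2 (hτ.1.trans hτ.2)
  have hYc : ‖Y c‖ ≤ M / β₀ := by
    have h := hode c hc
    rw [hwc, zero_smul] at h
    exact norm_le_of_stagnation hβ₀ hM h (hB c hc) (hF c hc)
  rcases eq_or_lt_of_le hτ.1 with h | hcτ
  · rw [← h]; exact hYc
  rw [le_iff_forall_pos_le_add]
  intro ε hε
  obtain ⟨δ, hδ, hδY⟩ := Metric.continuousAt_iff.1 (hderiv c hc).continuousAt ε hε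
  set a : ℝ := min τ (c + δ / 2) with ha
  have hca : c < a := lt_min hcτ (by linarith)
  have haτ : a ≤ τ := min_le_left _ _
  have hdist : dist a c < δ := by
    rw [Real.dist_eq, abs_of_pos (by linarith)]
    have : a ≤ c + δ / 2 := min_le_right _ _
    linarith
  have hYa : ‖Y a‖ ≤ (M + β₀ * ε) / β₀ := by
    have h1 : ‖Y a - Y c‖ < ε := by rw [← dist_eq_norm]; exact hδY hdist
    calc ‖Y a‖ = ‖Y c + (Y a - Y c)‖ := by rw [add_sub_cancel]
      _ ≤ ‖Y c‖ + ‖Y a - Y c‖ := norm_add_le _ _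
      _ ≤ M / β₀ + ε := add_le_add hYc h1.le
      _ = (M + β₀ * ε) / β₀ := by field_simp
  have hsub : Icc a b ⊆ Icc c b := Icc_subset_Icc hca.le le_rfl
  have hfence := transport_norm_le_of_damped (a := a) (b := b) hβ₀ (by positivity : 0 ≤ M + β₀ * ε)
    (fun t ht => hderiv t (hsub ht)) (fun t ht => hode t (hsub ht)) (fun t ht => hw t ⟨lt_of_lt_of_le hca ht.1, ht.2⟩)
    (fun t ht => hB t (hsub ht)) (fun t ht => (hF t (hsub ht)).trans (by nlinarith)) hYa τ ⟨haτ, hτ.2⟩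
  calc ‖Y τ‖ ≤ (M + β₀ * ε) / β₀ := hfence
    _ = M / β₀ + ε := by field_simp

/-! ## §2 Lab frame with the own-core rotation: the regular–singular point -/

/-- At the stagnation point, lab frame: `0 = iG z + α z + β z̄ + f` ⟹ `(G − ‖α‖ − ‖β‖)·‖z‖ ≤ ‖f‖`. [folklore] -/
theorem norm_le_of_stagnation_rot {z f α β : ℂ} {G : ℝ} (hG : 0 < G) (hode : (0 : ℂ) = I * G * z + α * z + β * conj z + f) :
    (G - ‖α‖ - ‖β‖) * ‖z‖ ≤ ‖f‖ := by
  have e : (I * G + α) * z = -(β * conj z + f) := by linear_combination -hode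
  have hIG : ‖I * (G : ℂ)‖ = G := by
    rw [norm_mul, Complex.norm_I, one_mul, Complex.norm_real, Real.norm_eq_abs, abs_of_pos hG]
  have h1 : (G - ‖α‖) * ‖z‖ ≤ ‖(I * G + α) * z‖ := by
    rw [norm_mul]
    refine mul_le_mul_of_nonneg_right ?_ (norm_nonneg _)
    have : ‖I * (G : ℂ)‖ ≤ ‖I * G + α‖ + ‖α‖ := by
      calc ‖I * (G : ℂ)‖ = ‖(I * G + α) - α‖ := by rw [add_sub_cancel_right]
        _ ≤ ‖I * G + α‖ + ‖α‖ := norm_sub_le _ _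
    linarith
  have h2 : ‖(I * G + α) * z‖ ≤ ‖β‖ * ‖z‖ + ‖f‖ := by
    rw [e, norm_neg]
    calc ‖β * conj z + f‖ ≤ ‖β * conj z‖ + ‖f‖ := norm_add_le _ _
      _ = ‖β‖ * ‖z‖ + ‖f‖ := by rw [norm_mul, Complex.norm_conj]
  nlinarith [norm_nonneg z]

/-- The phase factor `e^{−iθ}` is unimodular. [folklore] -/
theorem norm_cexp_neg_I_mul (θ : ℝ) : ‖cexp (-I * (θ : ℂ))‖ = 1 := by
  rw [Complex.norm_exp]; simp

/-- ★ **DAMPED TRANSPORT FROM THE STAGNATION POINT, LAB FRAME WITH ROTATION.**  Let `w·z′ = iG·z + α·z + β·z̄ + f` on `[c, b]` (`z ∈ C¹`),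
`w` continuous, `w(c) = 0`, `w > 0` on `(c, b]`, `‖f‖ ≤ M`, `‖β‖ ≤ G`, with the J-averaged damping margin
`β₀ ≤ −Re α − (k/(1−k))(2|Im α| + k‖β‖)`, `k = ‖β‖/(2G)`, and `β₀ ≤ G − ‖α‖ − ‖β‖` (the algebraic equation at the waist).  Then
`‖z τ‖ ≤ ((1+k)M/β₀)/(1−k)` on `[c, b]`.  The rotating frame `θ = ∫ G/w` exists only on `(c, b]` (regular–singular point); it is built on
`[a, b]` for `a ↓ c` and the landed `rotatingFrame` + `farBranch_norm_le_of_damped` give the bound there. [folklore] -/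
theorem waist_norm_le_of_damped {z z' f : ℝ → ℂ} {w : ℝ → ℝ} {c b G M β₀ : ℝ} {α β : ℂ}
    (hG : 0 < G) (hM : 0 ≤ M) (hβ₀ : 0 < β₀)
    (hz : ∀ τ ∈ Icc c b, HasDerivAt z (z' τ) τ) (hwcont : Continuous w) (hwc : w c = 0) (hw : ∀ τ ∈ Ioc c b, 0 < w τ)
    (hode : ∀ τ ∈ Icc c b, (w τ : ℂ) * z' τ = I * G * z τ + α * z τ + β * conj (z τ) + f τ)
    (hf : ∀ τ ∈ Icc c b, ‖f τ‖ ≤ M) (hsmall : ‖β‖ ≤ G)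
    (hgain : β₀ ≤ -α.re - (‖β‖ / (2 * G)) / (1 - ‖β‖ / (2 * G)) * (2 * |α.im| + ‖β‖ / (2 * G) * ‖β‖))
    (hstag : β₀ ≤ G - ‖α‖ - ‖β‖) :
    ∀ τ ∈ Icc c b, ‖z τ‖ ≤ ((1 + ‖β‖ / (2 * G)) * M / β₀) / (1 - ‖β‖ / (2 * G)) := by
  have hk0 : 0 ≤ ‖β‖ / (2 * G) := by positivity
  have hk1 : ‖β‖ / (2 * G) ≤ 1 / 2 := by rw [div_le_iff₀ (by positivity)]; linarith
  have h1k : 0 < 1 - ‖β‖ / (2 * G) := by linarith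
  have h1k' : 0 < 1 + ‖β‖ / (2 * G) := by linarith
  have hK : M / β₀ ≤ ((1 + ‖β‖ / (2 * G)) * M / β₀) / (1 - ‖β‖ / (2 * G)) := by
    rw [le_div_iff₀ h1k]
    have h0 : 0 ≤ M / β₀ := by positivity
    have e : (1 + ‖β‖ / (2 * G)) * M / β₀ = M / β₀ * (1 + ‖β‖ / (2 * G)) := by ring
    rw [e]; nlinarith
  intro τ hτ
  have hc : c ∈ Icc c b := left_mem_Icc.2 (hτ.1.trans hτ.2)
  -- the value at the stagnation point
  have hzc : ‖z c‖ ≤ M / β₀ := by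
    have h := hode c hc
    rw [hwc, Complex.ofReal_zero, zero_mul] at h
    have h1 := norm_le_of_stagnation_rot hG h
    have h2 : β₀ * ‖z c‖ ≤ M := by nlinarith [norm_nonneg (z c), hf c hc]
    rw [le_div_iff₀ hβ₀]; linarith
  rcases eq_or_lt_of_le hτ.1 with h | hcτ
  · rw [← h]; exact hzc.trans hK
  rw [le_iff_forall_pos_le_add]
  intro ε hε
  -- the initial point `a ∈ (c, τ]`
  set ε' : ℝ := ε * (1 - ‖β‖ / (2 * G)) / (1 + ‖β‖ / (2 * G)) with hε'
  have hε'0 : 0 < ε' := by positivity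
  obtain ⟨δ, hδ, hδz⟩ := Metric.continuousAt_iff.1 (hz c hc).continuousAt ε' hε'0
  set a : ℝ := min τ (c + δ / 2) with ha
  have hca : c < a := lt_min hcτ (by linarith)
  have haτ : a ≤ τ := min_le_left _ _
  have hdist : dist a c < δ := by
    rw [Real.dist_eq, abs_of_pos (by linarith)]
    have : a ≤ c + δ / 2 := min_le_right _ _
    linarith
  have hza : ‖z a‖ ≤ (M + β₀ * ε') / β₀ := by
    have h1 : ‖z a - z c‖ < ε' := by rw [← dist_eq_norm]; exact hδz hdist
    calc ‖z a‖ = ‖z c + (z a - z c)‖ := by rw [add_sub_cancel]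
      _ ≤ ‖z c‖ + ‖z a - z c‖ := norm_add_le _ _
      _ ≤ M / β₀ + ε' := add_le_add hzc h1.le
      _ = (M + β₀ * ε') / β₀ := by field_simp
  have hsub : Icc a b ⊆ Icc c b := Icc_subset_Icc hca.le le_rfl
  have hwpos : ∀ t ∈ Icc a b, 0 < w t := fun t ht => hw t ⟨lt_of_lt_of_le hca ht.1, ht.2⟩
  -- the phase `θ = ∫ G/w` on `[a, b]`
  have hUopen : IsOpen {s : ℝ | 0 < w s} := isOpen_lt continuous_const hwcont
  have hcontU : ContinuousOn (fun s => G / w s) {s : ℝ | 0 < w s} :=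
    continuousOn_const.div hwcont.continuousOn fun s hs => ne_of_gt hs
  have hθ : ∀ t ∈ Icc a b, HasDerivAt (fun r => ∫ s in a..r, G / w s) (G / w t) t := by
    intro t ht
    have htU : t ∈ {s : ℝ | 0 < w s} := hwpos t ht
    refine intervalIntegral.integral_hasDerivAt_right ?_ (hcontU.stronglyMeasurableAtFilter hUopen t htU)
      (hcontU.continuousAt (hUopen.mem_nhds htU))
    refine ContinuousOn.intervalIntegrable (hcontU.mono fun s hs => ?_)
    rw [uIcc_of_le ht.1] at hs
    exact hwpos s ⟨hs.1, hs.2.trans ht.2⟩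
  have hwθ : ∀ t ∈ Icc a b, w t * (G / w t) = G := fun t ht => mul_div_cancel₀ G (hwpos t ht).ne'
  -- the rotating frame on `[a, b]`
  have hrot := fun t (ht : t ∈ Icc a b) => rotatingFrame (hz t (hsub ht)) (hθ t ht) (hwθ t ht) (hode t (hsub ht))
  have hg : ∀ t ∈ Icc a b, ‖cexp (-I * ((∫ s in a..t, G / w s : ℝ) : ℂ)) * f t‖ ≤ M + β₀ * ε' := by
    intro t ht
    rw [norm_mul, norm_cexp_neg_I_mul, one_mul]
    have := hf t (hsub ht)
    nlinarith
  have hua : ‖cexp (-I * ((∫ s in a..a, G / w s : ℝ) : ℂ)) * z a‖ ≤ (M + β₀ * ε') / β₀ := by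
    rw [norm_mul, norm_cexp_neg_I_mul, one_mul]; exact hza
  have hfence := farBranch_norm_le_of_damped (a := a) (b := b)
    (u := fun r => cexp (-I * ((∫ s in a..r, G / w s : ℝ) : ℂ)) * z r)
    (u' := fun t => cexp (-I * ((∫ s in a..t, G / w s : ℝ) : ℂ)) * (-I * ((G / w t : ℝ) : ℂ)) * z t
      + cexp (-I * ((∫ s in a..t, G / w s : ℝ) : ℂ)) * z' t)
    (g := fun t => cexp (-I * ((∫ s in a..t, G / w s : ℝ) : ℂ)) * f t)
    (θ := fun r => ∫ s in a..r, G / w s) (θ' := fun t => G / w t)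
    hG (by positivity : 0 ≤ M + β₀ * ε') hβ₀ (fun t ht => (hrot t ht).1) hθ hwpos hwθ (fun t ht => (hrot t ht).2) hg hsmall hgain hua
    τ ⟨haτ, hτ.2⟩
  have hzu : ‖z τ‖ = ‖cexp (-I * ((∫ s in a..τ, G / w s : ℝ) : ℂ)) * z τ‖ := by
    rw [norm_mul, norm_cexp_neg_I_mul, one_mul]
  rw [hzu]
  have hden1 : G * 2 - ‖β‖ ≠ 0 := ne_of_gt (by linarith)
  have hden2 : G * 2 + ‖β‖ ≠ 0 := ne_of_gt (by positivity)
  have hden3 : 2 * G - ‖β‖ ≠ 0 := ne_of_gt (by linarith)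
  have hden4 : 2 * G + ‖β‖ ≠ 0 := ne_of_gt (by positivity)
  calc _ ≤ ((1 + ‖β‖ / (2 * G)) * (M + β₀ * ε') / β₀) / (1 - ‖β‖ / (2 * G)) := hfence
    _ = ((1 + ‖β‖ / (2 * G)) * M / β₀) / (1 - ‖β‖ / (2 * G)) + ε := by
        rw [hε']; field_simp

/-! ## §3 The left side of the waist (reflection `τ ↦ 2c − τ`) -/

/-- **Left twin of `waist_norm_le_of_damped`.**  On `[b, c]` with `w(c) = 0`, `w < 0` on `[b, c)` (the slip points INTO the stagnation point from
both sides when `w′(c) > 0`), the same hypotheses give the same bound: reflect `s ↦ 2c − s`, under which `w̃(s) = −w(2c−s) > 0` and the ODE keeps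
its form. [folklore] -/
theorem waist_norm_le_of_damped_left {z z' f : ℝ → ℂ} {w : ℝ → ℝ} {c b G M β₀ : ℝ} {α β : ℂ}
    (hG : 0 < G) (hM : 0 ≤ M) (hβ₀ : 0 < β₀)
    (hz : ∀ τ ∈ Icc b c, HasDerivAt z (z' τ) τ) (hwcont : Continuous w) (hwc : w c = 0) (hw : ∀ τ ∈ Ico b c, w τ < 0)
    (hode : ∀ τ ∈ Icc b c, (w τ : ℂ) * z' τ = I * G * z τ + α * z τ + β * conj (z τ) + f τ)
    (hf : ∀ τ ∈ Icc b c, ‖f τ‖ ≤ M) (hsmall : ‖β‖ ≤ G)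
    (hgain : β₀ ≤ -α.re - (‖β‖ / (2 * G)) / (1 - ‖β‖ / (2 * G)) * (2 * |α.im| + ‖β‖ / (2 * G) * ‖β‖))
    (hstag : β₀ ≤ G - ‖α‖ - ‖β‖) :
    ∀ τ ∈ Icc b c, ‖z τ‖ ≤ ((1 + ‖β‖ / (2 * G)) * M / β₀) / (1 - ‖β‖ / (2 * G)) := by
  intro τ hτ
  -- reflected data on `[c, 2c - b]`
  have hmem : ∀ s ∈ Icc c (2 * c - b), 2 * c - s ∈ Icc b c := fun s hs => ⟨by linarith [hs.2], by linarith [hs.1]⟩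
  have hzr : ∀ s ∈ Icc c (2 * c - b), HasDerivAt (fun r => z (2 * c - r)) (-z' (2 * c - s)) s := by
    intro s hs
    have h1 : HasDerivAt (fun r : ℝ => 2 * c - r) (-1) s := by
      simpa using (hasDerivAt_id s).const_sub (2 * c)
    have h := (hz (2 * c - s) (hmem s hs)).scomp s h1
    simpa [Function.comp_def] using h
  have hwr : Continuous fun r => -w (2 * c - r) := (hwcont.comp (continuous_const.sub continuous_id)).neg
  have hwrc : -w (2 * c - c) = 0 := by rw [show 2 * c - c = c by ring, hwc, neg_zero]
  have hwrpos : ∀ s ∈ Ioc c (2 * c - b), 0 < -w (2 * c - s) := by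
    intro s hs
    have := hw (2 * c - s) ⟨by linarith [hs.2], by linarith [hs.1]⟩
    linarith
  have hoder : ∀ s ∈ Icc c (2 * c - b), ((-w (2 * c - s) : ℝ) : ℂ) * (-z' (2 * c - s))
      = I * G * z (2 * c - s) + α * z (2 * c - s) + β * conj (z (2 * c - s)) + f (2 * c - s) := by
    intro s hs
    rw [← hode (2 * c - s) (hmem s hs)]; push_cast; ring
  have hfr : ∀ s ∈ Icc c (2 * c - b), ‖f (2 * c - s)‖ ≤ M := fun s hs => hf _ (hmem s hs)
  have h := waist_norm_le_of_damped (z := fun r => z (2 * c - r)) (b := 2 * c - b) hG hM hβ₀ hzr hwr hwrc hwrpos hoder hfr hsmall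
    hgain hstag (2 * c - τ) ⟨by linarith [hτ.2], by linarith [hτ.1]⟩
  simpa using h

end Summit.NavierStokesRegularity.NavierStokesRegularity.Theorems.Clause13Transport
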